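import Summits.QuantumFields.YangMills.Theorems.AlphaInputsT3ACv3LinearLiftFluxSupplier
import Summits.QuantumFields.YangMills.Theorems.AlphaInputsT3ACv3LinearLiftFluxLoopSum
import Summits.QuantumFields.YangMills.Theorems.UnitScaleTiltProp7SymCentreFluxRegPr
import HarnessLib

/-!
# Route `UnitScaleTilt`, crux K1 child «MinimiserStabilityRegPr» (stmt-QuantumFields-19200), stub `stub_existenceMinimalOrbit` (EX), cure (ii-a) line «SYM-CENTRE» —
# «FLUX-SUPPLIER (T³)»: the flux-sector input of the (R4) assembly in ONE `obtain`, in the assembler's letters (★px6 g3 23:21Z TARGET SHAPE) — cell `ym3-torus`, width seat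
# `ym-ust-20520-w5` (g8)

WHAT.  ★★★`exists_flux_supplier_T3 (F) (n K) (h : n ≤ K) (Θ) (m) (φ₀)`: from the coarse angles `Θ` on `T^{(K−n)}` of run `K`, integers `m` with `|curl Θ − 2π·m| ≤ φ₀` off the
diagonal and `m(x;μμ) = 0`, `0 < φ₀`, `6φ₀ < 2π` and ONE loop window, it produces an INTEGER gauge `s` and a fine one-form `a` with (E) `linAvgIter (K − n) a = Θ − 2π·s`, (L) the
pointwise loop-sum guards `3·|loopSum (linAvgIter s' a) c i| < 1` at every level `s' < K − n` (★w4's `hloop`), and (R) `RegPr F n K (4·10⁶·φ₀) (gexpAt iσ₃ a)`.  Composition: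
✓`exists_flux_combine₂` (ZCLASS ∘ FLUX-LIFT ∘ ★px19's Lipschitz exact lift, class bound) → level-`s'` off-corner curl rows (✓`abs_curlAt_linAvgIter_le` for the smooth part + the
constant flux part) → ✓`abs_loopSum_linAvgIter_le_of_curl_off_corner` → (L); and the level-`0` real-part rows → ✓`regPr_gexpAt_sigma3_of_curl_rows_modZ` → (R).
HONEST FRAMING.  Composition of landed kernel facts with explicit (crude) constants; nothing of EX∕the crux∕`hSymCentre` proved or claimed; count-neutral helper
(`--supports stmt-QuantumFields-19200 --as helper`); def-free.  YM₃ on the torus is a RUNG (R3), not the Clay problem; no claim about d = 4, infinite volume or a mass gap.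

References: T. Bałaban, Commun. Math. Phys. 102 (1985) 277–309 [Balaban1985Variational] ((2), (6) p.278); Commun. Math. Phys. 109 (1987) 249–301 [Balaban1987RG1] ((0.4)+(0.11) p.253);
Commun. Math. Phys. 98 (1985) 17–51 [Balaban1985Averaging] ((9), (14) p.19, (19)–(20) p.21).
-/

set_option autoImplicit false

noncomputable section

open scoped Matrix.Norms.L2Operator

namespace Summit.QuantumFields.YangMills.Theorems.LinearLiftFlux

open scoped BigOperators
open Literature.MathematicalPhysics.QuantumFieldTheory.Balaban1983to89
open Literature.MathematicalPhysics.QuantumFieldTheory.Balaban1983to89.BlockAveraging (Idx)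
open Literature.MathematicalPhysics.QuantumFieldTheory.Balaban1983to89.T3ContinuumYM3Torus
open Literature.MathematicalPhysics.QuantumFieldTheory.Balaban1983to89.T3RegularMinimiser (regThreshold)
open Literature.MathematicalPhysics.QuantumFieldTheory.Balaban1983to89.T3PrintedRegularMinimiser (RegPr)
open Literature.MathematicalPhysics.QuantumFieldTheory.Balaban1983to89.B9AdOrthogonal (σ₃)
open Summit.QuantumFields.Balaban3D.Carriers (suGroupModel)
open Summit.QuantumFields.YangMills.Theorems.AbelianEML
open Summit.QuantumFields.YangMills.Theorems.LinearLiftSpread (hN hside)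
open Summit.QuantumFields.YangMills.Theorems.Prop7SymCentreAbelianDict (I_smul_sigma3_mem_lie)
open Summit.QuantumFields.YangMills.Theorems.Prop7SymCentreAbelianFibre (I_smul_sigma3_ne_zero)
open Summit.QuantumFields.YangMills.Theorems.Prop7SymCentreFluxRegPr (regPr_gexpAt_sigma3_of_curl_rows_modZ)

/-- The three coordinate directions of the T³ member exhaust `Fin 3`. [folklore] -/
theorem fin3_exhaust (F : T3Family) (K : ℕ) (κ : Fin (F.P K).d) :
    κ = (⟨0, by show 0 < 3; norm_num⟩ : Fin (F.P K).d) ∨ κ = (⟨1, by show 1 < 3; norm_num⟩ : Fin (F.P K).d) ∨ κ = (⟨2, by show 2 < 3; norm_num⟩ : Fin (F.P K).d) := by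
  obtain ⟨i, hi⟩ := κ
  have hi3 : i < 3 := hi
  interval_cases i
  · exact Or.inl rfl
  · exact Or.inr (Or.inl rfl)
  · exact Or.inr (Or.inr rfl)

/-- **★★★ «FLUX-SUPPLIER (T³)»** — see the module docstring. The window `hwin` is the loop guard `3·(π/2)·(((d+2)L)²/4)·(2·54³+1)·φ₀ < 1` (an `L`-only bound on `φ₀`).
[cite: Balaban1985Variational, (2)+(6) p.278; Balaban1987RG1, (0.4)+(0.11) p.253; Balaban1985Averaging, (19)-(20) p.21] -/
theorem exists_flux_supplier_T3 (F : T3Family) (n K : ℕ) (Θ : PBond (F.P K) (K - n) → ℝ) (m : Site (F.P K) (K - n) → Fin (F.P K).d → Fin (F.P K).d → ℤ)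
    {φ₀ : ℝ} (hφ0 : 0 < φ₀) (hφ : 6 * φ₀ < 2 * Real.pi)
    (hm : ∀ (x : Site (F.P K) (K - n)) (μ ν : Fin (F.P K).d), μ ≠ ν → |curlAt Θ x μ ν - 2 * Real.pi * m x μ ν| ≤ φ₀)
    (hmdiag : ∀ (x : Site (F.P K) (K - n)) (μ : Fin (F.P K).d), m x μ μ = 0)
    (hwin : 3 * (Real.pi / 2 * ((((((F.P K).d + 2) * (F.P K).L : ℕ) : ℝ) ^ 2 / 4) * ((2 * 54 ^ 3 + 1) * φ₀))) < 1) :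
    ∃ (s : PBond (F.P K) (K - n) → ℤ) (a : PBond (F.P K) 0 → ℝ),
      (linAvgIter (K - n) a = fun c => Θ c - 2 * Real.pi * s c) ∧
      (∀ s', s' < K - n → ∀ (c : PBond (F.P K) (s' + 1)) (i : Idx (F.P K)), 3 * |loopSum (linAvgIter s' a) c i| < 1) ∧
      RegPr F n K (4000000 * φ₀) (gexpAt (suGroupModel 2) I_smul_sigma3_mem_lie a) := by
  -- letters of the T³ member
  have hk : K - n ≤ (F.P K).m + (F.P K).K := by show K - n ≤ F.m + K; omega
  have hd3 : (F.P K).d = 3 := rfl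
  have h01 : (⟨0, by show 0 < 3; norm_num⟩ : Fin (F.P K).d) ≠ ⟨1, by show 1 < 3; norm_num⟩ := by intro h'; have := Fin.mk.inj_iff.mp h'; omega
  have h02 : (⟨0, by show 0 < 3; norm_num⟩ : Fin (F.P K).d) ≠ ⟨2, by show 2 < 3; norm_num⟩ := by intro h'; have := Fin.mk.inj_iff.mp h'; omega
  have h12 : (⟨1, by show 1 < 3; norm_num⟩ : Fin (F.P K).d) ≠ ⟨2, by show 2 < 3; norm_num⟩ := by intro h'; have := Fin.mk.inj_iff.mp h'; omega
  have hL1 : (1 : ℝ) ≤ ((F.P K).L : ℝ) := by exact_mod_cast (F.P K).L_pos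
  have hL0 : (0 : ℝ) < ((F.P K).L : ℝ) := by linarith
  have hLk : (0 : ℝ) < ((F.P K).L : ℝ) ^ (K - n) := by positivity
  -- all near-curl rows (the diagonal ones hold trivially)
  have hnear : ∀ (x : Site (F.P K) (K - n)) (μ ν : Fin (F.P K).d), |curlAt Θ x μ ν - 2 * Real.pi * m x μ ν| ≤ φ₀ := by
    intro x μ ν
    by_cases hμν : μ = ν
    · subst hμν; rw [curlAt_self, hmdiag]; simp only [Int.cast_zero, mul_zero, sub_zero, abs_zero]; exact hφ0.le
    · exact hm x μ ν hμν
  obtain ⟨s, q, a, a', hqanti, hqb, hE, ha1, ha2, hF⟩ := exists_flux_combine₂ (P := F.P K) h01 h02 h12 (fin3_exhaust F K) (K - n) hk Θ m hφ hnear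
  have e54 : (54 : ℝ) ^ (F.P K).d = 54 ^ 3 := by rw [hd3]
  have e54' : (54 : ℝ) ^ ((F.P K).d - 1) = 54 ^ 2 := by rw [hd3]
  rw [e54] at ha1
  rw [e54'] at ha2
  refine ⟨s, a, hE, ?_, ?_⟩
  · -- (L) the loop-sum guards from the corner-excused curl rows at every level
    -- sites per direction: `M₀ = L^k·M_k`
    have hM0 : ((F.P K).sitesPerDir 0 : ℝ) = ((F.P K).L : ℝ) ^ (K - n) * ((F.P K).sitesPerDir (K - n) : ℝ) := by
      rw [hN (K - n) hk, hside]; push_cast; ring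
    have hNk : (0 : ℝ) < ((F.P K).sitesPerDir (K - n) : ℝ) := by exact_mod_cast (by have := (F.P K).one_lt_sitesPerDir (K - n); omega)
    -- the smooth part at every level
    have hδa0 : (0 : ℝ) ≤ 54 ^ 3 * (2 * φ₀) / (((F.P K).L : ℝ) ^ (K - n)) ^ 2 := by positivity
    have hsmooth : ∀ (s' : ℕ) (x : Site (F.P K) s') (μ ν : Fin (F.P K).d),
        |curlAt (linAvgIter s' a') x μ ν| ≤ ((((F.P K).L : ℝ)) ^ 2) ^ s' * (54 ^ 3 * (2 * φ₀) / (((F.P K).L : ℝ) ^ (K - n)) ^ 2) := by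
      refine abs_curlAt_linAvgIter_le a' (fun p => ha1 p.src p.μ p.ν p.hμν.ne) (fun x μ ν => ?_)
      by_cases hμν : μ = ν
      · subst hμν; rw [curlAt_self, abs_zero]; exact hδa0
      · exact ha1 x μ ν hμν
    -- the constant flux part at every level `s' ≤ k`
    have hflux : ∀ (s' : ℕ), s' ≤ K - n → ∀ (μ ν : Fin (F.P K).d), μ ≠ ν →
        |2 * Real.pi * (q μ ν : ℝ) * (((((F.P K).L : ℝ)) ^ 2) ^ s' * (1 / (((F.P K).sitesPerDir 0 : ℝ)) ^ 2))| ≤ ((((F.P K).L : ℝ)) ^ 2) ^ s' * (φ₀ / (((F.P K).L : ℝ) ^ (K - n)) ^ 2) := by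
      intro s' _ μ ν hμν
      have hb := hqb μ ν hμν
      have hπ := Real.pi_pos
      rw [abs_mul, abs_mul, abs_of_pos (by positivity : (0:ℝ) < 2 * Real.pi), abs_of_nonneg (by positivity : (0:ℝ) ≤ ((((F.P K).L : ℝ)) ^ 2) ^ s' * (1 / (((F.P K).sitesPerDir 0 : ℝ)) ^ 2)), hM0]
      rw [show 2 * Real.pi * |(q μ ν : ℝ)| * (((((F.P K).L : ℝ)) ^ 2) ^ s' * (1 / ((((F.P K).L : ℝ) ^ (K - n) * ((F.P K).sitesPerDir (K - n) : ℝ))) ^ 2))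
          = ((((F.P K).L : ℝ)) ^ 2) ^ s' * ((2 * Real.pi * |(q μ ν : ℝ)|) / (((F.P K).sitesPerDir (K - n) : ℝ)) ^ 2 / (((F.P K).L : ℝ) ^ (K - n)) ^ 2) by
            field_simp]
      refine mul_le_mul_of_nonneg_left (div_le_div_of_nonneg_right ?_ (by positivity)) (by positivity)
      rw [div_le_iff₀ (by positivity)]; linarith
    -- the corner-excused curl rows at every level `s' < k`
    have hlev : ∀ s', s' < K - n → ∀ (x : Site (F.P K) s') (μ ν : Fin (F.P K).d), μ ≠ ν → ¬ (x μ = -1 ∧ x ν = -1) →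
        |curlAt (linAvgIter s' a) x μ ν| ≤ (2 * 54 ^ 3 + 1) * φ₀ := by
      intro s' hs' x μ ν hμν hnc
      rw [hF s' hs'.le x μ ν, if_neg hnc, mul_zero, add_zero]
      have h1 := hsmooth s' x μ ν
      have h2 := hflux s' hs'.le μ ν hμν
      have hpow : ((((F.P K).L : ℝ)) ^ 2) ^ s' ≤ (((F.P K).L : ℝ) ^ (K - n)) ^ 2 := by
        rw [← pow_mul, ← pow_mul, mul_comm (K - n) 2]
        exact pow_le_pow_right₀ hL1 (by omega)
      have hsum : ((((F.P K).L : ℝ)) ^ 2) ^ s' * (54 ^ 3 * (2 * φ₀) / (((F.P K).L : ℝ) ^ (K - n)) ^ 2)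
          + ((((F.P K).L : ℝ)) ^ 2) ^ s' * (φ₀ / (((F.P K).L : ℝ) ^ (K - n)) ^ 2) ≤ (2 * 54 ^ 3 + 1) * φ₀ := by
        rw [← mul_add, show 54 ^ 3 * (2 * φ₀) / (((F.P K).L : ℝ) ^ (K - n)) ^ 2 + φ₀ / (((F.P K).L : ℝ) ^ (K - n)) ^ 2
          = ((2 * 54 ^ 3 + 1) * φ₀) / (((F.P K).L : ℝ) ^ (K - n)) ^ 2 by ring]
        rw [mul_div_assoc', div_le_iff₀ (by positivity)]
        nlinarith [hpow, hφ0.le]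
      calc |curlAt (linAvgIter s' a') x μ ν - 2 * Real.pi * (q μ ν : ℝ) * (((((F.P K).L : ℝ)) ^ 2) ^ s' * (1 / (((F.P K).sitesPerDir 0 : ℝ)) ^ 2))|
          ≤ |curlAt (linAvgIter s' a') x μ ν| + |2 * Real.pi * (q μ ν : ℝ) * (((((F.P K).L : ℝ)) ^ 2) ^ s' * (1 / (((F.P K).sitesPerDir 0 : ℝ)) ^ 2))| := abs_sub _ _
        _ ≤ _ := (add_le_add h1 h2).trans hsum
    intro s' hs' c i
    have hB0 : ∀ _s : ℕ, (0 : ℝ) ≤ (2 * 54 ^ 3 + 1) * φ₀ := fun _ => by positivity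
    have hloop := abs_loopSum_linAvgIter_le_of_curl_off_corner (suGroupModel 2) I_smul_sigma3_mem_lie I_smul_sigma3_ne_zero (K - n) hk a
      (fun _ => (2 * 54 ^ 3 + 1) * φ₀) hB0 (fun t ht x μ ν hμν hnc => hlev t ht x μ ν hμν hnc) s' hs' c i
    linarith
  · -- (R) the regular space from the level-`0` real-part rows, modulo `2πℤ`
    have hM0 : ((F.P K).sitesPerDir 0 : ℝ) = ((F.P K).L : ℝ) ^ (K - n) * ((F.P K).sitesPerDir (K - n) : ℝ) := by
      rw [hN (K - n) hk, hside]; push_cast; ring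
    have hNk : (0 : ℝ) < ((F.P K).sitesPerDir (K - n) : ℝ) := by exact_mod_cast (by have := (F.P K).one_lt_sitesPerDir (K - n); omega)
    have hconst : ∀ μ ν : Fin (F.P K).d, μ ≠ ν → |2 * Real.pi * (q μ ν : ℝ) * (1 / (((F.P K).sitesPerDir 0 : ℝ)) ^ 2)| ≤ φ₀ / (((F.P K).L : ℝ) ^ (K - n)) ^ 2 := by
      intro μ ν hμν
      have hb := hqb μ ν hμν
      have hπ := Real.pi_pos
      rw [abs_mul, abs_mul, abs_of_pos (by positivity : (0:ℝ) < 2 * Real.pi), abs_of_nonneg (by positivity : (0:ℝ) ≤ 1 / (((F.P K).sitesPerDir 0 : ℝ)) ^ 2), hM0,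
        show 2 * Real.pi * |(q μ ν : ℝ)| * (1 / ((((F.P K).L : ℝ) ^ (K - n) * ((F.P K).sitesPerDir (K - n) : ℝ))) ^ 2)
          = ((2 * Real.pi * |(q μ ν : ℝ)|) / (((F.P K).sitesPerDir (K - n) : ℝ)) ^ 2) / (((F.P K).L : ℝ) ^ (K - n)) ^ 2 by field_simp]
      refine div_le_div_of_nonneg_right ?_ (by positivity)
      rw [div_le_iff₀ (by positivity)]; linarith
    refine regPr_gexpAt_sigma3_of_curl_rows_modZ F n K (4000000 * φ₀) a (fun x μ ν => q μ ν * (if x μ = -1 ∧ x ν = -1 then 1 else 0))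
      (δ₁ := (2 * 54 ^ 3 + 1) * φ₀ / (((F.P K).L : ℝ) ^ (K - n)) ^ 2) (δ₂ := 330 * 54 ^ 2 * (2 * φ₀) / (((F.P K).L : ℝ) ^ (K - n)) ^ 3)
      (fun x μ ν hμν => ?_) (fun x lam μ ν hμν => ?_) ?_ ?_
    · -- sup of the real part
      have e := hF 0 (Nat.zero_le _) x μ ν
      simp only [linAvgIter, pow_zero, one_mul, id_eq] at e
      have hz : (2 * Real.pi * (((q μ ν * (if x μ = -1 ∧ x ν = -1 then 1 else 0) : ℤ)) : ℝ)) = 2 * Real.pi * (q μ ν : ℝ) * (if x μ = -1 ∧ x ν = -1 then 1 else 0) := by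
        push_cast; split_ifs <;> simp
      rw [hz, e, show curlAt a' x μ ν - 2 * Real.pi * (q μ ν : ℝ) * (1 / (((F.P K).sitesPerDir 0 : ℝ)) ^ 2) + 2 * Real.pi * (q μ ν : ℝ) * (if x μ = -1 ∧ x ν = -1 then 1 else 0)
          - 2 * Real.pi * (q μ ν : ℝ) * (if x μ = -1 ∧ x ν = -1 then 1 else 0) = curlAt a' x μ ν - 2 * Real.pi * (q μ ν : ℝ) * (1 / (((F.P K).sitesPerDir 0 : ℝ)) ^ 2) by ring]
      calc _ ≤ |curlAt a' x μ ν| + |2 * Real.pi * (q μ ν : ℝ) * (1 / (((F.P K).sitesPerDir 0 : ℝ)) ^ 2)| := abs_sub _ _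
        _ ≤ 54 ^ 3 * (2 * φ₀) / (((F.P K).L : ℝ) ^ (K - n)) ^ 2 + φ₀ / (((F.P K).L : ℝ) ^ (K - n)) ^ 2 := add_le_add (ha1 x μ ν hμν) (hconst μ ν hμν)
        _ = (2 * 54 ^ 3 + 1) * φ₀ / (((F.P K).L : ℝ) ^ (K - n)) ^ 2 := by ring
    · -- Lipschitz of the real part = Lipschitz of the smooth part
      have e1 := hF 0 (Nat.zero_le _) x μ ν
      have e2 := hF 0 (Nat.zero_le _) (x.shift lam) μ ν
      simp only [linAvgIter, pow_zero, one_mul, id_eq] at e1 e2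
      have hz : ∀ y : Site (F.P K) 0, (2 * Real.pi * (((q μ ν * (if y μ = -1 ∧ y ν = -1 then 1 else 0) : ℤ)) : ℝ)) = 2 * Real.pi * (q μ ν : ℝ) * (if y μ = -1 ∧ y ν = -1 then 1 else 0) := by
        intro y; push_cast; split_ifs <;> simp
      rw [hz, hz, e1, e2]
      have := ha2 x lam μ ν hμν
      rw [show (curlAt a' (x.shift lam) μ ν - 2 * Real.pi * (q μ ν : ℝ) * (1 / (((F.P K).sitesPerDir 0 : ℝ)) ^ 2) + 2 * Real.pi * (q μ ν : ℝ) * (if (x.shift lam) μ = -1 ∧ (x.shift lam) ν = -1 then 1 else 0)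
          - 2 * Real.pi * (q μ ν : ℝ) * (if (x.shift lam) μ = -1 ∧ (x.shift lam) ν = -1 then 1 else 0))
          - (curlAt a' x μ ν - 2 * Real.pi * (q μ ν : ℝ) * (1 / (((F.P K).sitesPerDir 0 : ℝ)) ^ 2) + 2 * Real.pi * (q μ ν : ℝ) * (if x μ = -1 ∧ x ν = -1 then 1 else 0)
          - 2 * Real.pi * (q μ ν : ℝ) * (if x μ = -1 ∧ x ν = -1 then 1 else 0)) = curlAt a' (x.shift lam) μ ν - curlAt a' x μ ν by ring]
      exact this
    · -- window 1: `(2·54³+1)φ₀/L^{2k} < 4·10⁶φ₀·L^{−2k}`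
      unfold regThreshold
      rw [show (F.L : ℝ) = ((F.P K).L : ℝ) from rfl, inv_pow, ← one_div, show (1 : ℝ) / ((F.P K).L : ℝ) ^ (2 * (K - n)) = 1 / (((F.P K).L : ℝ) ^ (K - n)) ^ 2 by
        rw [← pow_mul, mul_comm], mul_one_div, div_lt_div_iff_of_pos_right (by positivity)]
      nlinarith
    · -- window 2: `2·330·54²·2φ₀/L^{3k} < 4·10⁶φ₀·L^{−3k}`
      rw [show (((F.P K).d - 1 : ℕ) : ℝ) = 2 by rw [hd3]; norm_num, show (F.L : ℝ) = ((F.P K).L : ℝ) from rfl, inv_pow, ← one_div,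
        show (1 : ℝ) / ((F.P K).L : ℝ) ^ (3 * (K - n)) = 1 / (((F.P K).L : ℝ) ^ (K - n)) ^ 3 by rw [← pow_mul, mul_comm], mul_one_div,
        show (2 : ℝ) * (330 * 54 ^ 2 * (2 * φ₀) / (((F.P K).L : ℝ) ^ (K - n)) ^ 3) = (2 * 330 * 54 ^ 2 * 2 * φ₀) / (((F.P K).L : ℝ) ^ (K - n)) ^ 3 by ring,
        div_lt_div_iff_of_pos_right (by positivity)]
      nlinarith

end Summit.QuantumFields.YangMills.Theorems.LinearLiftFlux

end
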